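import Mathlib.Data.Rat.Cast.Order
import Mathlib.Data.Real.Basic
import Mathlib.Tactic.FieldSimp
import Mathlib.Tactic.Ring
import Mathlib.Tactic.Linarith
import Mathlib.Tactic.Positivity
import HarnessLib

/-!
# Finite-graph witness engine, V: kernel-decidable sign certificates for rational polynomials

Topic `Literature/Computation/FiniteGraph`; everything proved, no facts. Coefficient lists
`p : List ℚ` (low degree first) denote the real polynomial `peval p x = p₀ + x (p₁ + x (…))`.
The finite-graph polynomials of the engine (SAW length counts, reliability and Ising
polynomials) are compared at an irrational point known only up to an interval — the critical
fugacity `x_c = 1/μ(ℤ²) ∈ [200/539, 5/13]` of the square-lattice self-avoiding walk — so an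
inequality between them is certified by the SIGN of a difference polynomial on an interval:

* arithmetic `padd`, `psmul`, `pmul`, `psub`, `ofNatList` with the evaluation homomorphisms;
* the Taylor shift `pshift p c` (`peval (pshift p c) y = peval p (c + y)`);
* the nested lower bound `plb p h` with `plb p h ≤ peval p y` for `0 ≤ y ≤ h` (`plb_le_peval`);
* the certificate `posCert p lo hi depth` (shift to `lo`, bound on `[0, hi − lo]`, bisect up to
  `depth` times) and its soundness `posCert_sound`: `0 < peval p x` for all real `x ∈ [lo, hi]`.

Exact rational arithmetic, structural recursion only (`decide +kernel` / `native_decide`). This is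
the elementary branch-and-bound of validated numerics (cf. Moore 1966, Ch. 3); the tree's
`Literature.Analysis.ValidatedNumerics.PolyMP` does the same with dyadic interval coefficients —
here the coefficients are exact, which is all the combinatorial polynomials need. [folklore]

## References
* R. E. Moore, *Interval Analysis*, Prentice-Hall 1966, Ch. 3 [Moore1966].
-/

namespace Literature.Computation.FiniteGraph

/-! ### Evaluation and arithmetic of coefficient lists -/

/-- Horner evaluation `p₀ + x (p₁ + x (…))` of a rational coefficient list at a real point. [folklore] -/
def peval : List ℚ → ℝ → ℝ
  | [], _ => 0
  | c :: p, x => (c : ℝ) + x * peval p x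

/-- [folklore] -/
@[simp] theorem peval_nil (x : ℝ) : peval [] x = 0 := rfl

/-- [folklore] -/
@[simp] theorem peval_cons (c : ℚ) (p : List ℚ) (x : ℝ) : peval (c :: p) x = (c : ℝ) + x * peval p x := rfl

/-- Coefficientwise sum. [folklore] -/
def padd : List ℚ → List ℚ → List ℚ
  | [], q => q
  | c :: p, [] => c :: p
  | c :: p, d :: q => (c + d) :: padd p q

/-- [folklore] -/
theorem peval_padd : ∀ (p q : List ℚ) (x : ℝ), peval (padd p q) x = peval p x + peval q x
  | [], q, x => by simp [padd]
  | c :: p, [], x => by simp [padd]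
  | c :: p, d :: q, x => by
      rw [padd, peval_cons, peval_padd p q x, peval_cons, peval_cons]
      push_cast
      ring

/-- Scalar multiple. [folklore] -/
def psmul (a : ℚ) : List ℚ → List ℚ
  | [] => []
  | c :: p => (a * c) :: psmul a p

/-- [folklore] -/
theorem peval_psmul (a : ℚ) : ∀ (p : List ℚ) (x : ℝ), peval (psmul a p) x = (a : ℝ) * peval p x
  | [], x => by simp [psmul]
  | c :: p, x => by
      rw [psmul, peval_cons, peval_psmul a p x, peval_cons]
      push_cast
      ring

/-- Product: `(c + x p) q = c q + x (p q)`. [folklore] -/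
def pmul : List ℚ → List ℚ → List ℚ
  | [], _ => []
  | c :: p, q => padd (psmul c q) (0 :: pmul p q)

/-- [folklore] -/
theorem peval_pmul : ∀ (p q : List ℚ) (x : ℝ), peval (pmul p q) x = peval p x * peval q x
  | [], q, x => by simp [pmul]
  | c :: p, q, x => by
      rw [pmul, peval_padd, peval_psmul, peval_cons, peval_pmul p q x, peval_cons]
      push_cast
      ring

/-- Difference. [folklore] -/
def psub (p q : List ℚ) : List ℚ := padd p (psmul (-1) q)

/-- [folklore] -/
theorem peval_psub (p q : List ℚ) (x : ℝ) : peval (psub p q) x = peval p x - peval q x := by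
  rw [psub, peval_padd, peval_psmul]
  push_cast
  ring

/-- A list of natural numbers (e.g. walk counts by length) as a coefficient list. [folklore] -/
def ofNatList : List ℕ → List ℚ
  | [] => []
  | k :: l => (k : ℚ) :: ofNatList l

/-- `peval (ofNatList l) x = Σ_k l_k x^k`, in the Horner form used by the counting recursions:
`peval (ofNatList (k :: l)) x = k + x · peval (ofNatList l) x`. [folklore] -/
@[simp] theorem peval_ofNatList_cons (k : ℕ) (l : List ℕ) (x : ℝ) :
    peval (ofNatList (k :: l)) x = (k : ℝ) + x * peval (ofNatList l) x := by
  rw [ofNatList, peval_cons, Rat.cast_natCast]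

/-- [folklore] -/
@[simp] theorem peval_ofNatList_nil (x : ℝ) : peval (ofNatList []) x = 0 := rfl

/-- A coefficient list of naturals evaluates to a nonnegative number at `x ≥ 0`. [folklore] -/
theorem peval_ofNatList_nonneg : ∀ (l : List ℕ) {x : ℝ}, 0 ≤ x → 0 ≤ peval (ofNatList l) x
  | [], _, _ => le_rfl
  | k :: l, x, hx => by
      rw [peval_ofNatList_cons]
      exact add_nonneg (Nat.cast_nonneg k) (mul_nonneg hx (peval_ofNatList_nonneg l hx))

/-! ### Taylor shift -/

/-- One Horner step of the Taylor shift: the coefficient list of `c₀ + (c + y) · acc(y)`. [folklore] -/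
def pshiftStep (c c₀ : ℚ) (acc : List ℚ) : List ℚ :=
  padd [c₀] (padd (psmul c acc) (0 :: acc))

/-- [folklore] -/
theorem peval_pshiftStep (c c₀ : ℚ) (acc : List ℚ) (y : ℝ) :
    peval (pshiftStep c c₀ acc) y = (c₀ : ℝ) + ((c : ℝ) + y) * peval acc y := by
  rw [pshiftStep, peval_padd, peval_padd, peval_psmul, peval_cons, peval_cons, peval_nil]
  ring

/-- The Taylor shift: the coefficient list (in `y`) of `p (c + y)`. [folklore] -/
def pshift (p : List ℚ) (c : ℚ) : List ℚ :=
  p.foldr (pshiftStep c) []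

/-- [folklore] -/
theorem peval_pshift (c : ℚ) : ∀ (p : List ℚ) (y : ℝ), peval (pshift p c) y = peval p ((c : ℝ) + y)
  | [], y => by simp [pshift]
  | c₀ :: p, y => by
      have h := peval_pshift c p y
      simp only [pshift, List.foldr_cons] at h ⊢
      rw [peval_pshiftStep, h, peval_cons]

/-! ### A nested lower bound on `[0, h]` and the sign certificate -/

/-- `plb p h`: a lower bound for `peval p` on `[0, h]`, `plb (c :: p) h = c + min 0 (h · plb p h)`.
[folklore] -/
def plb : List ℚ → ℚ → ℚ
  | [], _ => 0
  | c :: p, h => c + min 0 (h * plb p h)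

/-- **The lower bound is one**: `plb p h ≤ peval p y` for `0 ≤ y ≤ h`. [folklore] -/
theorem plb_le_peval : ∀ (p : List ℚ) {h : ℚ} {y : ℝ}, 0 ≤ y → y ≤ (h : ℝ) → (plb p h : ℝ) ≤ peval p y
  | [], _, _, _, _ => by simp [plb]
  | c :: p, h, y, h0, hy => by
      have ih := plb_le_peval p h0 hy
      have key : ((min 0 (h * plb p h) : ℚ) : ℝ) ≤ y * peval p y := by
        rcases le_or_gt 0 (plb p h : ℝ) with hL | hL
        · calc ((min 0 (h * plb p h) : ℚ) : ℝ) ≤ 0 := by exact_mod_cast min_le_left _ _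
            _ ≤ y * peval p y := mul_nonneg h0 (hL.trans ih)
        · calc ((min 0 (h * plb p h) : ℚ) : ℝ) ≤ (h : ℝ) * (plb p h : ℝ) := by exact_mod_cast min_le_right _ _
            _ ≤ y * (plb p h : ℝ) := by nlinarith
            _ ≤ y * peval p y := mul_le_mul_of_nonneg_left ih h0
      rw [plb, peval_cons, Rat.cast_add]
      linarith

/-- One cell of the certificate: after shifting to `lo`, the nested bound on `[0, hi − lo]` is
positive. [folklore] -/
def posCertCell (p : List ℚ) (lo hi : ℚ) : Bool :=
  decide (0 < plb (pshift p lo) (hi - lo))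

/-- Soundness of one cell. [folklore] -/
theorem posCertCell_sound {p : List ℚ} {lo hi : ℚ} (h : posCertCell p lo hi = true) {x : ℝ}
    (hlo : (lo : ℝ) ≤ x) (hhi : x ≤ (hi : ℝ)) : 0 < peval p x := by
  rw [posCertCell, decide_eq_true_eq] at h
  have hb := plb_le_peval (pshift p lo) (h := hi - lo) (y := x - lo) (by linarith) (by push_cast; linarith)
  rw [peval_pshift] at hb
  have hx : (lo : ℝ) + (x - lo) = x := by ring
  rw [hx] at hb
  have h' : (0 : ℝ) < (plb (pshift p lo) (hi - lo) : ℝ) := by exact_mod_cast h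
  linarith

/-- **The sign certificate**: positivity of `peval p` on `[lo, hi]` by the cell test, bisecting up
to `depth` times. [folklore] -/
def posCert (p : List ℚ) : ℕ → ℚ → ℚ → Bool
  | 0, lo, hi => posCertCell p lo hi
  | d + 1, lo, hi => posCertCell p lo hi ||
      (posCert p d lo ((lo + hi) / 2) && posCert p d ((lo + hi) / 2) hi)

/-- **Soundness of the sign certificate**: if `posCert p depth lo hi` then `0 < peval p x` for every
real `x ∈ [lo, hi]`. [folklore] -/
theorem posCert_sound {p : List ℚ} : ∀ {d : ℕ} {lo hi : ℚ}, posCert p d lo hi = true →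
    ∀ {x : ℝ}, (lo : ℝ) ≤ x → x ≤ (hi : ℝ) → 0 < peval p x
  | 0, lo, hi, h, x, hlo, hhi => posCertCell_sound h hlo hhi
  | d + 1, lo, hi, h, x, hlo, hhi => by
      rw [posCert, Bool.or_eq_true, Bool.and_eq_true] at h
      rcases h with h | ⟨h₁, h₂⟩
      · exact posCertCell_sound h hlo hhi
      · rcases le_or_gt x (((lo + hi) / 2 : ℚ) : ℝ) with hx | hx
        · exact posCert_sound h₁ hlo hx
        · exact posCert_sound h₂ hx.le hhi

/-- Example (kernel): `x² − 2x + 1.001 > 0` on `[0, 2]` needs bisection near the near-double root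
at `1`; depth `8` suffices. -/
example : posCert [(1001 : ℚ) / 1000, -2, 1] 8 0 2 = true := by decide +kernel

end Literature.Computation.FiniteGraph
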